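import Summits.Langlands.Langlands.Theses.TowerDoorSplit
import Literature.NumberTheory.Automorphic.CaraianiNewtonModularity
import Literature.NumberTheory.Automorphic.ThorneQInfinityModular
import Literature.NumberTheory.Automorphic.AbelianTotallyRealModularity
/-! BC3 birth skeleton for residual `UnanchoredHighDegreeWitnessAutomorphy` (REST) of node/route `TowerDoorSplit` (lens-5 g19): 5 named stubs (sorry) + ONE closed composition `UnanchoredHighDegreeWitnessAutomorphy_proof` (real proof below the `have` lines). POST-BIRTH form: imports the route file and concludes the ROUTE decl by name (elaborates once Theses/TowerDoorSplit.lean exists). -/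
set_option linter.dupNamespace false
set_option linter.unusedVariables false
open scoped BigOperators Topology Manifold Classical MeasureTheory ProbabilityTheory Matrix InnerProductSpace ComplexConjugate ContinuousMap
open Filter Set Function TopologicalSpace MeasureTheory
-- SKELETON SHAPE (writer-1 WORD (A)(61), bus L1461): ONE closed theorem `<Crux>_proof : <crux decl>` whose `have` lines invoke the sorried stubs; no stub is typed `… → <crux decl>`.
namespace Summit.Langlands.Langlands.Cruxes.UnanchoredHighDegreeWitnessAutomorphy.Birth

/-- INTEGRAL-MODEL TRANSFER, pointwise (routine in print — clear denominators u ∈ 𝓞_{K₀}∖0, E ≅ E' over K₀, ρ_{E,ℓ} ≃ ρ_{E',ℓ}; in Lean an M-sized lemma about `WeierstrassCurve.framedTateGaloisRep` under `VariableChange` — the tree has `framedTateGaloisRep` but no isomorphism-invariance lemma yet): a field-model TR sandwich witness (E/K₀, χ) yields an integral one (E'/𝓞_{K₀}, χ') over the SAME L and K₀. -/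
theorem stub_integralModel :
    ∀ (K : Type) [Field K] [NumberField K] (ℓ : ℕ) [Fact ℓ.Prime] (ρ : Literature.NumberTheory.GaloisRepresentations.FramedGaloisRep K (PadicAlgCl ℓ) 2) (L : Type) [Field L] [NumberField L] [Algebra K L], IsGalois K L → IsSolvable (L ≃ₐ[K] L) → ∀ (K₀ : Type) [Field K₀] [NumberField K₀] [Algebra K₀ L], IsGalois K₀ L → IsSolvable (L ≃ₐ[K₀] L) → ∀ (E : WeierstrassCurve K₀) [E.IsElliptic] (χ : Literature.NumberTheory.GaloisRepresentations.FramedGaloisRep L (PadicAlgCl ℓ) 1), (∀ g : Field.absoluteGaloisGroup L, Literature.NumberTheory.GaloisRepresentations.FramedRep.trace (ρ.restrictField L) g = Literature.NumberTheory.GaloisRepresentations.FramedRep.trace χ g * Literature.NumberTheory.GaloisRepresentations.FramedRep.trace ((E.framedTateGaloisRep ℓ).restrictField L) g) → ∃ (E' : WeierstrassCurve (NumberField.RingOfIntegers K₀)) (_ : (E'.baseChange K₀).IsElliptic) (χ' : Literature.NumberTheory.GaloisRepresentations.FramedGaloisRep L (PadicAlgCl ℓ) 1), ∀ g : Field.absoluteGaloisGroup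 L, Literature.NumberTheory.GaloisRepresentations.FramedRep.trace (ρ.restrictField L) g = Literature.NumberTheory.GaloisRepresentations.FramedRep.trace χ' g * Literature.NumberTheory.GaloisRepresentations.FramedRep.trace (((E'.baseChange K₀).framedTateGaloisRep ℓ).restrictField L) g := by
  sorry

/-- THE DECLARED RESIDUAL AT E-LEVEL (IDEA-NEEDED; no print): every integral E (Δ ≠ 0) over every totally real K₀ of degree ≥ 6 that is NOT abelian-unramified-at-3·5·7-or-cyclotomic (A), NOT a 15-stable odd solvable cover of a degree-≤5 field (B5), NOT a 21-stable one (B7), is modular.  Strictly weaker than «all curves over all TR fields of degree ≥ 6» (`TowerDoorSplit.unanchored_of_highDegree`); the only print in its direction is potential modularity and Thorne 2026 (arXiv:2608.07186, 100 % of genus-2 curves/ℚ) — neither reaches a fixed unanchored sextic field. -/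
theorem stub_unanchored :
    ∀ (K₀ : Type) [Field K₀] [NumberField K₀], NumberField.IsTotallyReal K₀ → ¬ (Module.finrank ℚ K₀ ≤ 5) → ¬ ((IsGalois ℚ K₀ ∧ (∀ σ τ : K₀ ≃ₐ[ℚ] K₀, σ * τ = τ * σ) ∧ ¬ ((3 : ℤ) ∣ NumberField.discr K₀) ∧ ¬ ((5 : ℤ) ∣ NumberField.discr K₀) ∧ ¬ ((7 : ℤ) ∣ NumberField.discr K₀)) ∨ (∃ p : ℕ, p.Prime ∧ Literature.NumberTheory.Automorphic.Thorne2019.IsInCyclotomicZpExtension p K₀)) → ¬ (¬ IsSquare (5 : K₀) ∧ ∃ F : IntermediateField ℚ K₀, Module.finrank ℚ F ≤ 5 ∧ IsGalois F K₀ ∧ IsSolvable (K₀ ≃ₐ[F] K₀) ∧ Odd (Module.finrank F K₀) ∧ ∀ x y : K₀, (Literature.NumberTheory.Automorphic.Thorne2019.E₁.baseChange K₀).toAffine.Equation x y → x ∈ Set.range (algebraMap F K₀) ∧ y ∈ Set.range (algebraMap F K₀)) → ¬ (¬ ((7 : ℤ) ∣ NumberField.discr K₀) ∧ ∃ F : IntermediateField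 ℚ K₀, Module.finrank ℚ F ≤ 5 ∧ IsGalois F K₀ ∧ IsSolvable (K₀ ≃ₐ[F] K₀) ∧ Odd (Module.finrank F K₀) ∧ ∀ x y : K₀, ((⟨1, 0, 0, -4, -1⟩ : WeierstrassCurve ℚ).baseChange K₀).toAffine.Equation x y → x ∈ Set.range (algebraMap F K₀) ∧ y ∈ Set.range (algebraMap F K₀)) → ∀ E : WeierstrassCurve (NumberField.RingOfIntegers K₀), E.Δ ≠ 0 → Literature.NumberTheory.Automorphic.IsModularEllipticCurve K₀ E := by
  sorry

/-- TRANY = host item `EllipticDegreeLadder.EllipticTransportAnyBase` (stmt-Langlands-31038) BY NAME: W⁺|₂ → R1 → transport of weak automorphy from «every integral curve over 𝓞_{K₀} is modular» through the solvable sandwich to ρ.  PRINT (Arthur–Clozel). -/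
theorem stub_trany :
    Summit.Langlands.Langlands.Theses.EllipticDegreeLadder.EllipticTransportAnyBase := by
  sorry

/-- W⁺|₂ = host item `EllipticDegreeLadder.SatakeAvatarExistence` (stmt-Langlands-17415) AT n = 2, text VERBATIM the first antecedent of TRANY 31038 / ETP: every L-algebraic cuspidal π on GL₂/K has an irreducible ℓ-adic Galois avatar matching its Satake parameters a.e. (HLTT/Scholze + purity; over TR/CM fields print, in general open) — closes with the host item (`TowerDoorSplit.avatarTwo_of_satakeAvatarExistence`). -/
theorem stub_avatar2 :
    ∀ (K : Type) [Field K] [NumberField K] (hcpt : Literature.NumberTheory.Automorphic.isCompact_glFiniteIntegralLevel 2 K) (π : Literature.NumberTheory.Automorphic.CuspidalAutomorphicRepData 2 K hcpt), π.1.IsLAlgebraic → ∀ (ℓ : ℕ) [Fact ℓ.Prime] (ι : PadicAlgCl ℓ ≃+* ℂ), ∃ ρ : Literature.NumberTheory.GaloisRepresentations.FramedGaloisRep K (PadicAlgCl ℓ) 2, ρ.toGaloisRep.IsIrreducible ∧ ∀ᶠ v : IsDedekindDomain.HeightOneSpectrum (NumberField.RingOfIntegers K) in Filter.cofinite, SatakeFrobCompatibleAt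 ι π.1 ρ v := by
  sorry

/-- R1 = host item `EllipticDegreeLadder.RankOneAutomorphy` (stmt-Langlands-24805) BY NAME (cross-route by-name stub, tree precedent `stub_pairLBoundaryJS : AnalyticDescent.PairLBoundaryJS`) — automorphy of pinned-geometric ℓ-adic characters (class field theory + Weil); one proof closes both. -/
theorem stub_rankOne :
    Summit.Langlands.Langlands.Theses.EllipticDegreeLadder.RankOneAutomorphy := by
  sorry

/-- composition (real proof, no sorry outside the stubs): the stubs imply the cell. -/
theorem UnanchoredHighDegreeWitnessAutomorphy_proof :
    Summit.Langlands.Langlands.Theses.TowerDoorSplit.UnanchoredHighDegreeWitnessAutomorphy := by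
  have hI : (∀ (K : Type) [Field K] [NumberField K] (ℓ : ℕ) [Fact ℓ.Prime] (ρ : Literature.NumberTheory.GaloisRepresentations.FramedGaloisRep K (PadicAlgCl ℓ) 2) (L : Type) [Field L] [NumberField L] [Algebra K L], IsGalois K L → IsSolvable (L ≃ₐ[K] L) → ∀ (K₀ : Type) [Field K₀] [NumberField K₀] [Algebra K₀ L], IsGalois K₀ L → IsSolvable (L ≃ₐ[K₀] L) → ∀ (E : WeierstrassCurve K₀) [E.IsElliptic] (χ : Literature.NumberTheory.GaloisRepresentations.FramedGaloisRep L (PadicAlgCl ℓ) 1), (∀ g : Field.absoluteGaloisGroup L, Literature.NumberTheory.GaloisRepresentations.FramedRep.trace (ρ.restrictField L) g = Literature.NumberTheory.GaloisRepresentations.FramedRep.trace χ g * Literature.NumberTheory.GaloisRepresentations.FramedRep.trace ((E.framedTateGaloisRep ℓ).restrictField L) g) → ∃ (E' : WeierstrassCurve (NumberField.RingOfIntegers K₀)) (_ : (E'.baseChange K₀).IsElliptic) (χ' : Literature.NumberTheory.GaloisRepresentations.FramedGaloisRep L (PadicAlgCl ℓ) 1), ∀ g : Field.absoluteGaloisGroup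 L, Literature.NumberTheory.GaloisRepresentations.FramedRep.trace (ρ.restrictField L) g = Literature.NumberTheory.GaloisRepresentations.FramedRep.trace χ' g * Literature.NumberTheory.GaloisRepresentations.FramedRep.trace (((E'.baseChange K₀).framedTateGaloisRep ℓ).restrictField L) g) := stub_integralModel
  have hE : (∀ (K₀ : Type) [Field K₀] [NumberField K₀], NumberField.IsTotallyReal K₀ → ¬ (Module.finrank ℚ K₀ ≤ 5) → ¬ ((IsGalois ℚ K₀ ∧ (∀ σ τ : K₀ ≃ₐ[ℚ] K₀, σ * τ = τ * σ) ∧ ¬ ((3 : ℤ) ∣ NumberField.discr K₀) ∧ ¬ ((5 : ℤ) ∣ NumberField.discr K₀) ∧ ¬ ((7 : ℤ) ∣ NumberField.discr K₀)) ∨ (∃ p : ℕ, p.Prime ∧ Literature.NumberTheory.Automorphic.Thorne2019.IsInCyclotomicZpExtension p K₀)) → ¬ (¬ IsSquare (5 : K₀) ∧ ∃ F : IntermediateField ℚ K₀, Module.finrank ℚ F ≤ 5 ∧ IsGalois F K₀ ∧ IsSolvable (K₀ ≃ₐ[F] K₀) ∧ Odd (Module.finrank F K₀) ∧ ∀ x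 y : K₀, (Literature.NumberTheory.Automorphic.Thorne2019.E₁.baseChange K₀).toAffine.Equation x y → x ∈ Set.range (algebraMap F K₀) ∧ y ∈ Set.range (algebraMap F K₀)) → ¬ (¬ ((7 : ℤ) ∣ NumberField.discr K₀) ∧ ∃ F : IntermediateField ℚ K₀, Module.finrank ℚ F ≤ 5 ∧ IsGalois F K₀ ∧ IsSolvable (K₀ ≃ₐ[F] K₀) ∧ Odd (Module.finrank F K₀) ∧ ∀ x y : K₀, ((⟨1, 0, 0, -4, -1⟩ : WeierstrassCurve ℚ).baseChange K₀).toAffine.Equation x y → x ∈ Set.range (algebraMap F K₀) ∧ y ∈ Set.range (algebraMap F K₀)) → ∀ E : WeierstrassCurve (NumberField.RingOfIntegers K₀), E.Δ ≠ 0 → Literature.NumberTheory.Automorphic.IsModularEllipticCurve K₀ E) := stub_unanchored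
  have hTr : (Summit.Langlands.Langlands.Theses.EllipticDegreeLadder.EllipticTransportAnyBase) := stub_trany
  have hW : (∀ (K : Type) [Field K] [NumberField K] (hcpt : Literature.NumberTheory.Automorphic.isCompact_glFiniteIntegralLevel 2 K) (π : Literature.NumberTheory.Automorphic.CuspidalAutomorphicRepData 2 K hcpt), π.1.IsLAlgebraic → ∀ (ℓ : ℕ) [Fact ℓ.Prime] (ι : PadicAlgCl ℓ ≃+* ℂ), ∃ ρ : Literature.NumberTheory.GaloisRepresentations.FramedGaloisRep K (PadicAlgCl ℓ) 2, ρ.toGaloisRep.IsIrreducible ∧ ∀ᶠ v : IsDedekindDomain.HeightOneSpectrum (NumberField.RingOfIntegers K) in Filter.cofinite, SatakeFrobCompatibleAt ι π.1 ρ v) := stub_avatar2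
  have h1 : (Summit.Langlands.Langlands.Theses.EllipticDegreeLadder.RankOneAutomorphy) := stub_rankOne
  intro K _ _ hcpt ℓ _ ι ρ hirr hgeo htw hP
  obtain ⟨hno, ⟨L, _, _, _, hgal, hsol, K₀, _, _, _, hgal₀, hsol₀, hTR, E, hEll, χ, hvia⟩, hnA, hnB5, hnB7⟩ := hP
  obtain ⟨E', hEll', χ', hvia'⟩ := hI K ℓ ρ L hgal hsol K₀ hgal₀ hsol₀ E χ hvia
  have hdeg : ¬ (Module.finrank ℚ K₀ ≤ 5) := fun hle =>
    hno ⟨L, inferInstance, inferInstance, inferInstance, hgal, hsol, K₀, inferInstance, inferInstance, inferInstance, hgal₀, hsol₀, hTR, hle, E, hEll, χ, hvia⟩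
  have hA : ¬ ((IsGalois ℚ K₀ ∧ (∀ σ τ : K₀ ≃ₐ[ℚ] K₀, σ * τ = τ * σ) ∧ ¬ ((3 : ℤ) ∣ NumberField.discr K₀) ∧ ¬ ((5 : ℤ) ∣ NumberField.discr K₀) ∧ ¬ ((7 : ℤ) ∣ NumberField.discr K₀)) ∨ (∃ p : ℕ, p.Prime ∧ Literature.NumberTheory.Automorphic.Thorne2019.IsInCyclotomicZpExtension p K₀)) := fun h =>
    hnA ⟨L, inferInstance, inferInstance, inferInstance, hgal, hsol, K₀, inferInstance, inferInstance, inferInstance, hgal₀, hsol₀, hTR, h, E', hEll', χ', hvia'⟩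
  have hB5 : ¬ (¬ IsSquare (5 : K₀) ∧ ∃ F : IntermediateField ℚ K₀, Module.finrank ℚ F ≤ 5 ∧ IsGalois F K₀ ∧ IsSolvable (K₀ ≃ₐ[F] K₀) ∧ Odd (Module.finrank F K₀) ∧ ∀ x y : K₀, (Literature.NumberTheory.Automorphic.Thorne2019.E₁.baseChange K₀).toAffine.Equation x y → x ∈ Set.range (algebraMap F K₀) ∧ y ∈ Set.range (algebraMap F K₀)) := fun h =>
    hnB5 ⟨L, inferInstance, inferInstance, inferInstance, hgal, hsol, K₀, inferInstance, inferInstance, inferInstance, hgal₀, hsol₀, hTR, h, E', hEll', χ', hvia'⟩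
  have hB7 : ¬ (¬ ((7 : ℤ) ∣ NumberField.discr K₀) ∧ ∃ F : IntermediateField ℚ K₀, Module.finrank ℚ F ≤ 5 ∧ IsGalois F K₀ ∧ IsSolvable (K₀ ≃ₐ[F] K₀) ∧ Odd (Module.finrank F K₀) ∧ ∀ x y : K₀, ((⟨1, 0, 0, -4, -1⟩ : WeierstrassCurve ℚ).baseChange K₀).toAffine.Equation x y → x ∈ Set.range (algebraMap F K₀) ∧ y ∈ Set.range (algebraMap F K₀)) := fun h =>
    hnB7 ⟨L, inferInstance, inferInstance, inferInstance, hgal, hsol, K₀, inferInstance, inferInstance, inferInstance, hgal₀, hsol₀, hTR, h, E', hEll', χ', hvia'⟩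
  exact hTr hW h1 K hcpt ℓ ι ρ hirr hgeo htw L hgal hsol K₀ hgal₀ hsol₀ E χ hvia (fun E₀ hΔ => hE K₀ hTR hdeg hA hB5 hB7 E₀ hΔ)

end Summit.Langlands.Langlands.Cruxes.UnanchoredHighDegreeWitnessAutomorphy.Birth
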